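import Summits.Ventures.CertifiedArithmetic.LowPrec.GemmThetaE2M3
import Summits.Ventures.CertifiedArithmetic.LowPrec.GemmWorstCaseE2M1
import Summits.Ventures.CertifiedArithmetic.LowPrec.GemmTerminalE2M3

/-!
# Prop. Θ(i) for E2M3²→bfloat16, kernel-checked: `1 - W(n) ≥ 1746/(679n + 168386)` for every `n`

HONEST FRAMING (venture CertifiedArithmetic / cell `pub-lowprec`, seat gemm, gen 7): certified error
envelopes and provably optimal rounding/accumulation schemes for low-precision formats under stated
cost models; every table by two implementations; no hardware or vendor claims.

Paper `gemm.tex` §Regimes, Prop. "the terminal constant bounds the defect for every n" (i), for the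
FP6 configuration E2M3·E2M3 → `bfloat16` (exact products, sequential accumulation, RNE; value set
[RouhaniEtAl2023MX, Table 1]).  From the kernel-checked certificate `thetaCert_E2M3_BFloat16`
(`GemmThetaE2M3.lean`, 1,588,598 edges) and the generic soundness theorem
`ThetaCertificate.defect_bound`:
* `defect_bound_E2M3_BFloat16`: `1746/(679n + 168386) ≤ 1 - (ŝ_m - Σ x)/Σ|x|` for every input of
  letters `x 0 … x m` (`n = m + 1`), and the two-sided `abs_err_le_E2M3_BFloat16`,
  `abs_dot_err_le_E2M3_BFloat16` (the GEMM phrasing over E2M3 data `a j`, `b j`, via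
  `mul_mem_piE2M3`: every product is a letter, checked on the `32²` pairs of significand magnitudes);
* `W(n)` of this configuration as a Lean term (`worstRelErrE2M3BF16 m`, the maximum of `relErr` over
  the `443^(m+1)` words) with `worstE2M3_le` (the bound above, every `n`), `worstE2M3_ge` (the
  tie-chain family `TieChain.e2m3_1346` of `GemmTerminalE2M3.lean`, `n ≥ 1346`) and the sandwich
  `1746/(679n + 168386) ≤ 1 - W(n) ≤ 54/(21n - 25487)` (`worstE2M3_sandwich`); the cell's two-implementation certificate (not kernel-checked) says the
  upper one is exact from `n = 3816` on (`certs/gemm/regimes/THETA.jsonl`, gemm.tex Prop. "all n" 2 (i)).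
Companion of `GemmThetaE3M2Bound.lean` (the other FP6 format).
-/

namespace Literature.ComputerArithmetic.FloatingPoint

namespace MiniFloat

open Finset ThetaE2M3

/-! ### Products of E2M3 data are letters -/

/-- The 32 significand magnitudes `scaledMag` of E2M3 data (`|x| = scaledMag · 2^-3`).
[RouhaniEtAl2023MX, Table 1] -/
def sigE2M3 : List ℕ :=
  [0, 1, 2, 3, 4, 5, 6, 7, 8, 9, 10, 11, 12, 13, 14, 15, 16, 18, 20, 22, 24, 26, 28, 30, 32, 36, 40, 44, 48, 52, 56, 60]

/-- Every E2M3 datum has its significand magnitude in `sigE2M3`. [cell, kernel-checked] -/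
theorem scaledMag_mem_sigE2M3 (a : MiniFloat Format.E2M3) : a.scaledMag ∈ sigE2M3 :=
  of_decide_eq_true (forall_of_all_all (P := fun a => decide (a.scaledMag ∈ sigE2M3))
    (by decide +kernel) a)

/-- Every product of significands `toInt a · toInt b` of E2M3 data is in `lamG` (the `32²` pairs of
significand magnitudes, kernel-checked, then signs). [cell] -/
theorem toInt_mul_mem_lamG_E2M3 (a b : MiniFloat Format.E2M3) : a.toInt * b.toInt ∈ lamG := by
  have h : (sigE2M3.all fun s => sigE2M3.all fun t => decide (((s * t : ℕ) : ℤ) ∈ lamG)) = true := by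
    decide +kernel
  have h1 : ((a.scaledMag * b.scaledMag : ℕ) : ℤ) ∈ lamG :=
    of_decide_eq_true (List.all_eq_true.mp (List.all_eq_true.mp h _ (scaledMag_mem_sigE2M3 a)) _
      (scaledMag_mem_sigE2M3 b))
  have h2 : -(((a.scaledMag * b.scaledMag : ℕ) : ℤ)) ∈ lamG :=
    lamG_neg_closed _ h1
  push_cast at h1 h2
  unfold toInt
  split_ifs
  · rw [neg_mul_neg]; exact h1
  · rw [neg_mul]; exact h2
  · rw [mul_neg]; exact h2
  · exact h1

/-- Every `E2M3 · E2M3` product is a letter of `piE2M3`. [cell] -/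
theorem mul_mem_piE2M3 (a b : MiniFloat Format.E2M3) : a.toRat * b.toRat ∈ piE2M3 := by
  rw [toRat_mul_toRat_E2M3]
  exact List.mem_map.mpr ⟨_, toInt_mul_mem_lamG_E2M3 a b, rfl⟩

/-- The letters are closed under negation. [cell] -/
theorem neg_mem_piE2M3 {q : ℚ} (hq : q ∈ piE2M3) : -q ∈ piE2M3 := by
  obtain ⟨Q, hQ, rfl⟩ := exists_of_mem_piE2M3 hq
  have h := lamG_neg_closed Q hQ
  exact List.mem_map.mpr ⟨-Q, h, by push_cast; ring⟩

/-! ### The bound -/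

/-- PROP. Θ(i) FOR E2M3²→bfloat16, KERNEL-CHECKED: for every input of E2M3·E2M3 products
`x 0, …, x m` (`n = m + 1` terms, not all zero) accumulated sequentially in `bfloat16` (RNE),
`1746/(679n + 168386) ≤ 1 - (ŝ_m - Σ x)/Σ|x|`. [cell, gemm.tex §Regimes Prop. Θ(i) — now a theorem] -/
theorem defect_bound_E2M3_BFloat16 (x : ℕ → ℚ) (hx : ∀ j, x j ∈ piE2M3) (m : ℕ)
    (hL : 0 < ∑ j ∈ range (m + 1), |x j|) :
    1746 / (679 * (m + 1) + 168386)
      ≤ 1 - ((seqSum Format.BFloat16 x m).toRat - ∑ j ∈ range (m + 1), x j)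
          / ∑ j ∈ range (m + 1), |x j| := by
  have h := thetaCert_E2M3_BFloat16.defect_bound x hx m hL
  rw [show max (63 / 2 : ℚ) (191 / 2) + 32 / 97 = 18591 / 194 by norm_num,
    theta_bound_E2M3_BFloat16_const] at h
  exact h

/-- TWO-SIDED FORM: `|ŝ_m - Σ x| ≤ (1 - 1746/(679n + 168386)) · Σ|x|` for every input of E2M3·E2M3
products into `bfloat16`, i.e. `W(n) ≤ (679n + 166640)/(679n + 168386)` for every `n`.
[cell, gemm.tex §Regimes Prop. Θ(i)] -/
theorem abs_err_le_E2M3_BFloat16 (x : ℕ → ℚ) (hx : ∀ j, x j ∈ piE2M3) (m : ℕ) :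
    |(seqSum Format.BFloat16 x m).toRat - ∑ j ∈ range (m + 1), x j|
      ≤ (1 - 1746 / (679 * (m + 1) + 168386)) * ∑ j ∈ range (m + 1), |x j| := by
  by_cases hL : ∑ j ∈ range (m + 1), |x j| = 0
  · -- all terms vanish
    have hz : ∀ j ∈ range (m + 1), x j = 0 := by
      intro j hj
      have := (sum_eq_zero_iff_of_nonneg fun i _ => abs_nonneg (x i)).mp hL j hj
      exact abs_eq_zero.mp this
    have hs : ∀ k ≤ m, (seqSum Format.BFloat16 x k).toRat = 0 := by
      intro k hk
      induction k with
      | zero => simp [seqSum, hz 0 (by simp), toRat_roundNE_zero]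
      | succ k ih =>
          simp only [seqSum]
          rw [ih (by omega), hz (k + 1) (mem_range.mpr (by omega)), add_zero, toRat_roundNE_zero]
    rw [hs m le_rfl, sum_eq_zero hz, hL]; simp
  · have hpos : 0 < ∑ j ∈ range (m + 1), |x j| :=
      lt_of_le_of_ne (sum_nonneg fun i _ => abs_nonneg (x i)) (Ne.symm hL)
    have h1 := defect_bound_E2M3_BFloat16 x hx m hpos
    have hx' : ∀ j, (fun j => -x j) j ∈ piE2M3 := fun j => neg_mem_piE2M3 (hx j)
    have h2 := defect_bound_E2M3_BFloat16 (fun j => -x j) hx' m (by simpa using hpos)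
    simp only [abs_neg, sum_neg_distrib, toRat_seqSum_neg] at h2
    rw [abs_le]
    constructor
    · have := (le_sub_comm.mp h2)
      rw [div_le_iff₀ hpos] at this
      linarith
    · have := (le_sub_comm.mp h1)
      rw [div_le_iff₀ hpos] at this
      linarith

/-- THE GEMM PHRASING: for every `n = m + 1` pairs of E2M3 data `a j, b j` (exact products,
accumulated sequentially in `bfloat16`, RNE) the inner-product error satisfies
`|ŝ - Σ a_j b_j| ≤ (1 - 1746/(679n + 168386)) · Σ|a_j b_j|`. [cell, gemm.tex §Regimes Prop. Θ(i)] -/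
theorem abs_dot_err_le_E2M3_BFloat16 (a b : ℕ → MiniFloat Format.E2M3) (m : ℕ) :
    |(seqSum Format.BFloat16 (fun j => (a j).toRat * (b j).toRat) m).toRat
        - ∑ j ∈ range (m + 1), (a j).toRat * (b j).toRat|
      ≤ (1 - 1746 / (679 * (m + 1) + 168386))
          * ∑ j ∈ range (m + 1), |(a j).toRat * (b j).toRat| :=
  abs_err_le_E2M3_BFloat16 _ (fun j => mul_mem_piE2M3 (a j) (b j)) m

/-! ### `W(n)` of E2M3²→bfloat16 as a defined maximum, sandwiched for `n ≥ 1346` -/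

/-- `piE2M3` has `443` letters. [cell] -/
theorem piE2M3_length : piE2M3.length = 443 := by decide +kernel

/-- THE INPUT SPELLED BY A WORD `w : Fin (m+1) → Fin 443` (letters of `piE2M3` by index; `0` after
position `m`). [cell, gemm.tex §Model] -/
def wordInputE2M3 {m : ℕ} (w : Fin (m + 1) → Fin 443) : ℕ → ℚ :=
  fun j => if h : j < m + 1 then piE2M3[(w ⟨j, h⟩).val]'(by rw [piE2M3_length]; exact (w _).isLt)
    else 0

/-- Every term of a word input is a letter. [cell] -/
theorem wordInputE2M3_mem {m : ℕ} (w : Fin (m + 1) → Fin 443) (j : ℕ) :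
    wordInputE2M3 w j ∈ piE2M3 := by
  unfold wordInputE2M3
  split_ifs
  · exact List.getElem_mem _
  · exact List.mem_map.mpr ⟨0, by decide, by simp⟩

/-- `W(n)` OF E2M3²→bfloat16 (sequential, RNE, exact products), `n = m + 1`: the maximum of the
relative error over all `443^(m+1)` inputs of letters. [cell, gemm.tex §Model] -/
def worstRelErrE2M3BF16 (m : ℕ) : ℚ :=
  (univ : Finset (Fin (m + 1) → Fin 443)).sup' univ_nonempty
    (fun w => relErr Format.BFloat16 (wordInputE2M3 w) m)

/-- Every input of letters is dominated by `W(n)`. [cell, gemm.tex §Model] -/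
theorem relErr_le_worstE2M3 (x : ℕ → ℚ) (hx : ∀ j, x j ∈ piE2M3) (m : ℕ) :
    relErr Format.BFloat16 x m ≤ worstRelErrE2M3BF16 m := by
  classical
  have hidx : ∀ j, ∃ i : Fin 443, ∀ h : i.val < piE2M3.length, piE2M3[i.val]'h = x j := by
    intro j
    obtain ⟨i, hi, h⟩ := List.getElem_of_mem (hx j)
    exact ⟨⟨i, by simpa [piE2M3_length] using hi⟩, fun _ => h⟩
  choose f hf using hidx
  have hxy : ∀ j ≤ m, x j = wordInputE2M3 (fun j : Fin (m + 1) => f j.val) j := by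
    intro j hj
    unfold wordInputE2M3
    rw [dif_pos (by omega)]
    exact (hf j _).symm
  rw [relErr_congr Format.BFloat16 hxy]
  exact le_sup' (fun w => relErr Format.BFloat16 (wordInputE2M3 w) m) (mem_univ _)

/-- UPPER BOUND FOR EVERY `n` (Prop. Θ(i), kernel-checked): `W(n) ≤ 1 - 1746/(679n + 168386)`.
[cell, gemm.tex §Regimes Prop. Θ(i)] -/
theorem worstE2M3_le (m : ℕ) :
    worstRelErrE2M3BF16 m ≤ 1 - 1746 / (679 * (m + 1) + 168386) := by
  apply sup'_le
  intro w _
  unfold relErr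
  have hc : (0 : ℚ) ≤ 1 - 1746 / (679 * (m + 1) + 168386) := by
    rw [sub_nonneg, div_le_one (by positivity)]; linarith [show (0 : ℚ) ≤ m from Nat.cast_nonneg m]
  by_cases hL : ∑ j ∈ range (m + 1), |wordInputE2M3 w j| = 0
  · rw [hL, div_zero]; exact hc
  · have hpos : 0 < ∑ j ∈ range (m + 1), |wordInputE2M3 w j| :=
      lt_of_le_of_ne (sum_nonneg fun i _ => abs_nonneg _) (Ne.symm hL)
    rw [div_le_iff₀ hpos]
    exact abs_err_le_E2M3_BFloat16 _ (wordInputE2M3_mem w) m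

/-- The tie-chain sub-alphabet `piE2M3fam` of `GemmTerminalE2M3.lean` lies in `piE2M3`. [cell] -/
theorem mem_piE2M3_of_mem_fam : ∀ p ∈ TieChain.piE2M3fam, p ∈ piE2M3 := by
  have h : (TieChain.piE2M3fam.all fun p => decide (p ∈ piE2M3)) = true := by decide +kernel
  intro p hp
  exact of_decide_eq_true (List.all_eq_true.mp h p hp)

/-- LOWER BOUND FOR EVERY `n ≥ 1346` (the terminal family, kernel-checked):
`(21n - 25541)/(21n - 25487) ≤ W(n)`. [cell, gemm.tex §Regimes Prop. "all n" 2 (i)] -/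
theorem worstE2M3_ge (m : ℕ) (hm : 1345 ≤ m) :
    (21 * ((m : ℚ) + 1) - 25541) / (21 * (m + 1) - 25487) ≤ worstRelErrE2M3BF16 m := by
  have h := TieChain.e2m3_1346_ratio (m + 1) (by omega)
  rw [Nat.add_sub_cancel] at h
  have hw := relErr_le_worstE2M3 TieChain.e2m3_1346
    (fun k => mem_piE2M3_of_mem_fam _ (TieChain.e2m3_1346_mem k)) m
  unfold relErr at hw
  rw [h] at hw
  push_cast at hw
  exact hw

/-- THE SANDWICH FOR EVERY `n ≥ 1346`, both sides kernel-checked: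
`1746/(679n + 168386) ≤ 1 - W(n) ≤ 54/(21n - 25487)`. [cell, gemm.tex §Regimes] -/
theorem worstE2M3_sandwich (m : ℕ) (hm : 1345 ≤ m) :
    1746 / (679 * ((m : ℚ) + 1) + 168386) ≤ 1 - worstRelErrE2M3BF16 m ∧
      1 - worstRelErrE2M3BF16 m ≤ 54 / (21 * ((m : ℚ) + 1) - 25487) := by
  refine ⟨by linarith [worstE2M3_le m], ?_⟩
  have h := worstE2M3_ge m hm
  have hm' : (1345 : ℚ) ≤ m := by exact_mod_cast hm
  have hden : (0 : ℚ) < 21 * ((m : ℚ) + 1) - 25487 := by linarith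
  have e : (21 * ((m : ℚ) + 1) - 25541) / (21 * (m + 1) - 25487)
      = 1 - 54 / (21 * ((m : ℚ) + 1) - 25487) := by
    field_simp; ring
  linarith [e]

end MiniFloat

end Literature.ComputerArithmetic.FloatingPoint
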